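import Literature.Geometry.DiscreteGeometry.UnitDiscBondAngles
import Mathlib.Analysis.Convex.Segment
import Mathlib.Analysis.Normed.Affine.Convex
import Mathlib.Topology.Connected.Basic
import HarnessLib

/-!
# Bonds of a unit-disc configuration as plane segments: no crossings, empty corner sectors

Topic `Literature/Geometry/DiscreteGeometry`, third file of the proof of Harborth's upper bound
[Harborth1974, (5)]; sequel to `UnitDiscBondAngles.lean`. Harborth (p. 14): "Werden die
Mittelpunkte sich berührender Kreise geradlinig miteinander verbunden, dann ergibt sich eine
Zerlegung der Ebene in gleichseitige Polygone" — the contact graph drawn with straight unit bonds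
is a PLANE graph. This file proves the elementary metric facts behind that sentence, for a hard
configuration `P : Finset ℂ` (centres pairwise `≥ 1` apart, bonds = pairs at distance `1`):

* `Harborth.disjoint_segment_of_darts` — two bonds with four distinct ends are disjoint closed
  segments (a common point would force four centres pairwise at distance `1`,
  `Harborth.not_four_unit_distances`);
* `Harborth.segment_inter_segment_subset` — two bonds at a common centre meet only there;
* `Harborth.sq_norm_sub_ge_of_mem_segment` — a centre `k` stays at distance `> 1/2`
  (`≥ √3/2`) from every bond not ending at `k`;
* `Harborth.drawing P` — the union of the centres and the bond segments;
* `Harborth.sector p u α β r` — the points at distance `∈ (0, r)` from `p` in directions at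
  counter-clockwise angle `∈ (α, β)` from `u`; it is preconnected (`isPreconnected_sector`, a
  continuous image of a rectangle), lies in the ball `B(p, r)`, and — the point of the file —
  **an empty angular gap is an empty corner**: if no neighbour of `p` other than `q` lies at
  counter-clockwise angle `< γ` from `q`, then `sector p (q - p) 0 γ r` (`r ≤ 1/2`) does not meet
  the drawing (`disjoint_sector_drawing`). Also the radii: a point at angle `0` (resp. the angle of
  a neighbour `w`) from `u` within distance `1` lies on the bond segment (`mem_segment_of_ccwAngle_eq`).

These are the inputs of the face-tracing of the outer boundary (next files).
-/

noncomputable section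

namespace Literature.Geometry.DiscreteGeometry

namespace Harborth

open Complex Set Metric
open scoped Real

variable {P : Finset ℂ}

/-! ## §1 Bonds do not cross -/

/-- **No four centres are pairwise at distance one** (there is no unit-distance `K₄` in the
plane: the two apices over a unit segment are `√3` apart). [folklore] -/
private theorem not_four_unit_distances {a b c d : ℂ} (hab : ‖b - a‖ = 1) (hac : ‖c - a‖ = 1)
    (had : ‖d - a‖ = 1) (hbc : ‖c - b‖ = 1) (hbd : ‖d - b‖ = 1) (hcd : ‖d - c‖ = 1) : False := by
  have he0 : b - a ≠ 0 := by rw [← norm_pos_iff, hab]; norm_num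
  have h1 : ‖(c - a) / (b - a)‖ = 1 := by rw [norm_div, hac, hab, div_one]
  have h2 : ‖(c - a) / (b - a) - 1‖ = 1 := by
    rw [div_sub_one he0, show c - a - (b - a) = c - b by ring, norm_div, hbc, hab, div_one]
  have h3 : ‖(d - a) / (b - a)‖ = 1 := by rw [norm_div, had, hab, div_one]
  have h4 : ‖(d - a) / (b - a) - 1‖ = 1 := by
    rw [div_sub_one he0, show d - a - (b - a) = d - b by ring, norm_div, hbd, hab, div_one]
  have h5 : ‖(d - a) / (b - a) - (c - a) / (b - a)‖ = 1 := by
    rw [← sub_div, show d - a - (c - a) = d - c by ring, norm_div, hcd, hab, div_one]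
  generalize (c - a) / (b - a) = α at h1 h2 h5
  generalize (d - a) / (b - a) = β at h3 h4 h5
  -- real coordinates
  have e1 : α.re ^ 2 + α.im ^ 2 = 1 := by
    have := congrArg (· ^ 2) h1; simp only [Complex.sq_norm, Complex.normSq_apply, one_pow] at this
    linarith
  have e2 : (α.re - 1) ^ 2 + α.im ^ 2 = 1 := by
    have := congrArg (· ^ 2) h2
    simp only [Complex.sq_norm, Complex.normSq_apply, one_pow, sub_re, one_re, sub_im, one_im,
      sub_zero] at this
    linarith
  have e3 : β.re ^ 2 + β.im ^ 2 = 1 := by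
    have := congrArg (· ^ 2) h3; simp only [Complex.sq_norm, Complex.normSq_apply, one_pow] at this
    linarith
  have e4 : (β.re - 1) ^ 2 + β.im ^ 2 = 1 := by
    have := congrArg (· ^ 2) h4
    simp only [Complex.sq_norm, Complex.normSq_apply, one_pow, sub_re, one_re, sub_im, one_im,
      sub_zero] at this
    linarith
  have e5 : (β.re - α.re) ^ 2 + (β.im - α.im) ^ 2 = 1 := by
    have := congrArg (· ^ 2) h5
    simp only [Complex.sq_norm, Complex.normSq_apply, one_pow, sub_re, sub_im] at this
    linarith
  have i1 : (α.re - 1) ^ 2 = α.re ^ 2 - 2 * α.re + 1 := by ring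
  have i2 : (β.re - 1) ^ 2 = β.re ^ 2 - 2 * β.re + 1 := by ring
  have hx : α.re = 1 / 2 := by linarith
  have hx' : β.re = 1 / 2 := by linarith
  have hxx : α.re ^ 2 = 1 / 4 := by rw [hx]; norm_num
  have hxx' : β.re ^ 2 = 1 / 4 := by rw [hx']; norm_num
  have hy : α.im ^ 2 = 3 / 4 := by linarith
  have hy' : β.im ^ 2 = 3 / 4 := by linarith
  have i3 : (β.im - α.im) ^ 2 = β.im ^ 2 - 2 * (α.im * β.im) + α.im ^ 2 := by ring
  have i4 : (β.re - α.re) ^ 2 = 0 := by rw [hx, hx']; norm_num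
  have hyy : α.im * β.im = 1 / 4 := by linarith
  have s1 : (α.im * β.im) ^ 2 = 1 / 16 := by rw [hyy]; norm_num
  have s2 : (α.im * β.im) ^ 2 = 9 / 16 := by rw [mul_pow, hy, hy']; norm_num
  linarith

/-- `dist` in `ℂ` in the orientation used by `IsHard` / `nbrs`. [folklore] -/
private theorem dist_eq_norm_sub' (p q : ℂ) : dist p q = ‖q - p‖ := by
  rw [dist_comm, dist_eq_norm]

/-- **Bonds do not cross**: two bonds of a hard configuration whose four ends are distinct are
disjoint closed segments. (A common point `x` gives `|pp'| + |qq'| ≤ |px| + |xp'| + |qx| + |xq'| = 2`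
and likewise `|pq'| + |qp'| ≤ 2`, so all six distances among `p, q, p', q'` equal `1`.)
[cite: Harborth1974, p. 14] -/
theorem disjoint_segment_of_darts (hP : IsHard P) {d d' : ℂ × ℂ} (hd : d ∈ darts P)
    (hd' : d' ∈ darts P) (h11 : d.1 ≠ d'.1) (h12 : d.1 ≠ d'.2) (h21 : d.2 ≠ d'.1)
    (h22 : d.2 ≠ d'.2) : Disjoint (segment ℝ d.1 d.2) (segment ℝ d'.1 d'.2) := by
  rw [Set.disjoint_left]
  intro x hx hx'
  obtain ⟨⟨hp, hq⟩, hpq⟩ := mem_darts.1 hd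
  obtain ⟨⟨hp', hq'⟩, hpq'⟩ := mem_darts.1 hd'
  have s1 : dist d.1 x + dist x d.2 = 1 := by
    rw [dist_add_dist_of_mem_segment hx, dist_eq_norm_sub', hpq]
  have s2 : dist d'.1 x + dist x d'.2 = 1 := by
    rw [dist_add_dist_of_mem_segment hx', dist_eq_norm_sub', hpq']
  have t1 := dist_triangle d.1 x d'.1
  have t2 := dist_triangle d.2 x d'.2
  have t3 := dist_triangle d.1 x d'.2
  have t4 := dist_triangle d.2 x d'.1
  have l1 := hP _ hp _ hp' h11
  have l2 := hP _ hq _ hq' h22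
  have l3 := hP _ hp _ hq' h12
  have l4 := hP _ hq _ hp' h21
  rw [← dist_eq_norm_sub'] at l1 l2 l3 l4
  have c1 : dist x d'.1 = dist d'.1 x := dist_comm _ _
  have c2 : dist d.2 x = dist x d.2 := dist_comm _ _
  have e1 : dist d.1 d'.1 = 1 := by linarith
  have e2 : dist d.2 d'.2 = 1 := by linarith
  have e3 : dist d.1 d'.2 = 1 := by linarith
  have e4 : dist d.2 d'.1 = 1 := by linarith
  rw [dist_eq_norm_sub'] at e1 e2 e3 e4
  -- six unit distances among `d.1, d.2, d'.1, d'.2`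
  exact not_four_unit_distances (a := d.1) (b := d.2) (c := d'.1) (d := d'.2) hpq e1 e3 e4 e2 hpq'

/-- Parametrisation of a point of a segment in `ℂ`. [folklore] -/
private theorem exists_eq_add_mul_of_mem_segment {p q x : ℂ} (hx : x ∈ segment ℝ p q) :
    ∃ t : ℝ, 0 ≤ t ∧ t ≤ 1 ∧ x = p + t * (q - p) := by
  rw [segment_eq_image'] at hx
  obtain ⟨t, ⟨h0, h1⟩, rfl⟩ := hx
  exact ⟨t, h0, h1, by simp [Complex.real_smul]⟩

/-- The point `p + t (q - p)`, `t ∈ [0, 1]`, lies on the segment. [folklore] -/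
private theorem add_mul_mem_segment {p q : ℂ} {t : ℝ} (h0 : 0 ≤ t) (h1 : t ≤ 1) :
    p + t * (q - p) ∈ segment ℝ p q := by
  rw [segment_eq_image']
  exact ⟨t, ⟨h0, h1⟩, by simp [Complex.real_smul]⟩

/-- **Two bonds at a common centre meet only there.** [cite: Harborth1974, p. 14] -/
theorem segment_inter_segment_subset {p q k : ℂ} (hq : q ∈ nbrs P p) (hk : k ∈ nbrs P p)
    (hqk : q ≠ k) : segment ℝ p q ∩ segment ℝ p k ⊆ {p} := by
  rintro x ⟨hxq, hxk⟩
  obtain ⟨t, ht0, -, rfl⟩ := exists_eq_add_mul_of_mem_segment hxq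
  obtain ⟨s, hs0, -, hs⟩ := exists_eq_add_mul_of_mem_segment hxk
  rw [Set.mem_singleton_iff]
  rcases ht0.eq_or_lt with rfl | ht
  · simp
  exfalso
  have hs' : (t : ℂ) * (q - p) = s * (k - p) := by
    have := hs; rw [add_right_inj] at this; exact this
  have hspos : 0 < s := by
    rcases hs0.eq_or_lt with rfl | h
    · exfalso
      simp only [Complex.ofReal_zero, zero_mul, mul_eq_zero, Complex.ofReal_eq_zero] at hs'
      rcases hs' with h | h
      · exact ht.ne' h
      · exact sub_ne_zero_of_mem_nbrs hq h
    · exact h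
  -- equal directions
  have hdir : ccwAngle (q - p) (k - p) = 0 := by
    have hs0' : (s : ℂ) ≠ 0 := by exact_mod_cast hspos.ne'
    have e : k - p = ((t / s : ℝ) : ℂ) * (q - p) := by
      rw [Complex.ofReal_div, div_mul_eq_mul_div, eq_div_iff hs0', mul_comm]
      exact hs'.symm
    rw [e, ccwAngle_real_mul _ _ (div_pos ht hspos), ccwAngle_self]
  exact hqk (eq_of_ccwAngle_eq_zero hq hk hdir)

/-- **A centre is far from every bond not ending at it**: if `k ≠ p, q` are centres of a hard
configuration and `|q - p| = 1`, every point `x` of the bond `[p, q]` has `|x - k|² ≥ 3/4`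
(the closest approach, `√3/2`, is the apex of the equilateral triangle). [cite: Harborth1974, p. 14] -/
theorem sq_norm_sub_ge_of_mem_segment (hP : IsHard P) {p q k x : ℂ} (hp : p ∈ P) (hq : q ∈ P)
    (hk : k ∈ P) (hkp : k ≠ p) (hkq : k ≠ q) (hpq : ‖q - p‖ = 1) (hx : x ∈ segment ℝ p q) :
    3 / 4 ≤ ‖x - k‖ ^ 2 := by
  obtain ⟨t, ht0, ht1, rfl⟩ := exists_eq_add_mul_of_mem_segment hx
  have he0 : q - p ≠ 0 := by rw [← norm_pos_iff, hpq]; norm_num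
  have hnorm : ‖p + t * (q - p) - k‖ = ‖(t : ℂ) - (k - p) / (q - p)‖ := by
    have : (t : ℂ) - (k - p) / (q - p) = (p + t * (q - p) - k) / (q - p) := by
      field_simp; ring
    rw [this, norm_div, hpq, div_one]
  have h1 : 1 ≤ ‖(k - p) / (q - p)‖ := by
    rw [norm_div, hpq, div_one]; exact hP p hp k hk hkp.symm
  have h2 : 1 ≤ ‖(k - p) / (q - p) - 1‖ := by
    rw [div_sub_one he0, show k - p - (q - p) = k - q by ring, norm_div, hpq, div_one]
    exact hP q hq k hk hkq.symm
  rw [hnorm]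
  generalize (k - p) / (q - p) = α at h1 h2
  have e0 : ‖(t : ℂ) - α‖ ^ 2 = (t - α.re) ^ 2 + α.im ^ 2 := by
    rw [Complex.sq_norm, Complex.normSq_apply]; simp; ring
  have e1 : 1 ≤ α.re ^ 2 + α.im ^ 2 := by
    have := pow_le_pow_left₀ zero_le_one h1 2
    rw [one_pow, Complex.sq_norm, Complex.normSq_apply] at this; linarith
  have e2 : 1 ≤ (α.re - 1) ^ 2 + α.im ^ 2 := by
    have := pow_le_pow_left₀ zero_le_one h2 2
    rw [one_pow, Complex.sq_norm, Complex.normSq_apply] at this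
    simp only [sub_re, one_re, sub_im, one_im, sub_zero] at this; linarith
  rw [e0]
  by_cases hb : 3 / 4 ≤ α.im ^ 2
  · nlinarith
  · push Not at hb
    by_cases ha : α.re ≤ 1 / 2
    · have ha' : α.re < -(1 / 2) := by nlinarith
      nlinarith
    · have ha' : 3 / 2 < α.re := by nlinarith
      nlinarith

/-- Corollary: `|x - k| > 1/2` for `x` on a bond not ending at the centre `k`.
[cite: Harborth1974, p. 14] -/
theorem half_lt_norm_sub_of_mem_segment (hP : IsHard P) {p q k x : ℂ} (hp : p ∈ P) (hq : q ∈ P)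
    (hk : k ∈ P) (hkp : k ≠ p) (hkq : k ≠ q) (hpq : ‖q - p‖ = 1) (hx : x ∈ segment ℝ p q) :
    1 / 2 < ‖x - k‖ := by
  have h := sq_norm_sub_ge_of_mem_segment hP hp hq hk hkp hkq hpq hx
  nlinarith [norm_nonneg (x - k)]

/-! ## §2 The drawing and the corner sectors -/

/-- The **drawing** of the contact graph: the centres together with the straight unit bonds
("Werden die Mittelpunkte sich berührender Kreise geradlinig miteinander verbunden …").
[cite: Harborth1974, p. 14] -/
def drawing (P : Finset ℂ) : Set ℂ := (P : Set ℂ) ∪ ⋃ d ∈ darts P, segment ℝ d.1 d.2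

/-- Centres belong to the drawing. [cite: Harborth1974, p. 14] -/
theorem mem_drawing_of_mem {p : ℂ} (hp : p ∈ P) : p ∈ drawing P := Or.inl (Finset.mem_coe.2 hp)

/-- Bond segments belong to the drawing. [cite: Harborth1974, p. 14] -/
theorem segment_subset_drawing {d : ℂ × ℂ} (hd : d ∈ darts P) : segment ℝ d.1 d.2 ⊆ drawing P :=
  fun _ hx => Or.inr (Set.mem_biUnion (Finset.mem_coe.2 hd) hx)

/-- Membership in the drawing, unfolded. [cite: Harborth1974, p. 14] -/
theorem mem_drawing_iff {x : ℂ} :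
    x ∈ drawing P ↔ x ∈ P ∨ ∃ d ∈ darts P, x ∈ segment ℝ d.1 d.2 := by
  simp only [drawing, Set.mem_union, Finset.mem_coe, Set.mem_iUnion, exists_prop]

/-- The **sector** at `p`: points at distance `∈ (0, r)` from `p` whose direction makes a
counter-clockwise angle `∈ (α, β)` with `u`. With `u = q - p` for a bond `[p, q]` and `(α, β)`
an angular gap free of bonds at `p`, this is a corner of a face of the drawing at `p`.
[cite: Harborth1974, p. 14] -/
def sector (p u : ℂ) (α β r : ℝ) : Set ℂ :=
  {x | 0 < ‖x - p‖ ∧ ‖x - p‖ < r ∧ α < ccwAngle u (x - p) ∧ ccwAngle u (x - p) < β}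

/-- Membership in a sector, unfolded. [cite: Harborth1974, p. 14] -/
theorem mem_sector_iff {p u x : ℂ} {α β r : ℝ} : x ∈ sector p u α β r ↔
    0 < ‖x - p‖ ∧ ‖x - p‖ < r ∧ α < ccwAngle u (x - p) ∧ ccwAngle u (x - p) < β := Iff.rfl

/-- A sector lies in the open ball. [cite: Harborth1974, p. 14] -/
theorem sector_subset_ball (p u : ℂ) (α β r : ℝ) : sector p u α β r ⊆ ball p r := fun x hx => by
  rw [mem_ball, dist_eq_norm]; exact hx.2.1

/-- The polar point `p + ρ u e^{iφ}` (`u` a unit vector, `ρ > 0`, `φ ∈ [0, 2π)`) is at distance `ρ`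
from `p` in the direction at counter-clockwise angle `φ` from `u`. [cite: Harborth1974, p. 14] -/
theorem norm_and_ccwAngle_polar {p u : ℂ} (hu : ‖u‖ = 1) {ρ φ : ℝ} (hρ : 0 < ρ) (h0 : 0 ≤ φ)
    (h1 : φ < 2 * π) :
    ‖p + ρ * (u * exp (φ * I)) - p‖ = ρ ∧ ccwAngle u (p + ρ * (u * exp (φ * I)) - p) = φ := by
  have hu0 : u ≠ 0 := by rw [← norm_pos_iff, hu]; norm_num
  rw [add_sub_cancel_left]
  refine ⟨?_, ?_⟩
  · rw [norm_mul, norm_mul, hu, Complex.norm_exp_ofReal_mul_I, Complex.norm_real, Real.norm_eq_abs,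
      abs_of_pos hρ]; ring
  · rw [ccwAngle_real_mul _ _ hρ, ccwAngle_mul_exp hu0 h0 h1]

/-- **The sector is the polar image of a rectangle** `(0, r) × (α, β)` (for
`0 ≤ α`, `β ≤ 2π`, `u` a unit vector). [cite: Harborth1974, p. 14] -/
theorem sector_eq_image {p u : ℂ} (hu : ‖u‖ = 1) {α β r : ℝ} (hα : 0 ≤ α) (hβ : β ≤ 2 * π) :
    sector p u α β r = (fun z : ℝ × ℝ => p + z.1 * (u * exp (z.2 * I))) '' (Ioo 0 r ×ˢ Ioo α β) := by
  ext x
  constructor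
  · rintro ⟨h0, hr, ha, hb⟩
    refine ⟨(‖x - p‖, ccwAngle u (x - p)), ⟨⟨h0, hr⟩, ha, hb⟩, ?_⟩
    simp only
    -- `x - p = ‖x - p‖ · v` with `v` the unit vector of `x - p`, and `v = u e^{i ccwAngle u v}`
    set v : ℂ := ((‖x - p‖⁻¹ : ℝ) : ℂ) * (x - p) with hv
    have hv1 : ‖v‖ = 1 := by
      rw [hv, norm_mul, Complex.norm_real, Real.norm_eq_abs, abs_of_pos (inv_pos.2 h0),
        inv_mul_cancel₀ h0.ne']
    have hang : ccwAngle u v = ccwAngle u (x - p) := by rw [hv, ccwAngle_real_mul _ _ (inv_pos.2 h0)]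
    have hvx : x - p = (‖x - p‖ : ℂ) * v := by
      rw [hv, ← mul_assoc, ← Complex.ofReal_mul, mul_inv_cancel₀ h0.ne', Complex.ofReal_one, one_mul]
    rw [← hang, ← eq_mul_exp_ccwAngle hu hv1, ← hvx, add_sub_cancel]
  · rintro ⟨⟨ρ, φ⟩, ⟨⟨hρ0, hρr⟩, hφa, hφb⟩, rfl⟩
    obtain ⟨hn, hang⟩ := norm_and_ccwAngle_polar (p := p) hu hρ0 (hα.trans hφa.le) (hφb.trans_le hβ)
    exact ⟨by rw [hn]; exact hρ0, by rw [hn]; exact hρr, by rw [hang]; exact hφa, by rw [hang]; exact hφb⟩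

/-- **Sectors are preconnected** (continuous image of a rectangle). [cite: Harborth1974, p. 14] -/
theorem isPreconnected_sector {p u : ℂ} (hu : ‖u‖ = 1) {α β r : ℝ} (hα : 0 ≤ α) (hβ : β ≤ 2 * π) :
    IsPreconnected (sector p u α β r) := by
  rw [sector_eq_image hu hα hβ]
  refine (isPreconnected_Ioo.prod isPreconnected_Ioo).image _ ?_
  exact (Continuous.continuousOn (by fun_prop))

/-- A polar point of the rectangle lies in the sector. [cite: Harborth1974, p. 14] -/
theorem polar_mem_sector {p u : ℂ} (hu : ‖u‖ = 1) {α β r ρ φ : ℝ} (hα : 0 ≤ α) (hβ : β ≤ 2 * π)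
    (hρ0 : 0 < ρ) (hρr : ρ < r) (hφa : α < φ) (hφb : φ < β) :
    p + ρ * (u * exp (φ * I)) ∈ sector p u α β r := by
  rw [sector_eq_image hu hα hβ]
  exact ⟨(ρ, φ), ⟨⟨hρ0, hρr⟩, hφa, hφb⟩, rfl⟩

/-- **A point in the direction of a unit vector `w` (seen from `p`, within distance `1`) lies on
the segment `[p, p + w]`.** [cite: Harborth1974, p. 14] -/
theorem mem_segment_of_ccwAngle_eq {p u w x : ℂ} (hu : ‖u‖ = 1) (hw : ‖w‖ = 1) (hx0 : x ≠ p)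
    (hx1 : ‖x - p‖ ≤ 1) (h : ccwAngle u (x - p) = ccwAngle u w) : x ∈ segment ℝ p (p + w) := by
  have h0 : 0 < ‖x - p‖ := norm_pos_iff.2 (sub_ne_zero.2 hx0)
  set v : ℂ := ((‖x - p‖⁻¹ : ℝ) : ℂ) * (x - p) with hv
  have hv1 : ‖v‖ = 1 := by
    rw [hv, norm_mul, Complex.norm_real, Real.norm_eq_abs, abs_of_pos (inv_pos.2 h0),
      inv_mul_cancel₀ h0.ne']
  have hang : ccwAngle u v = ccwAngle u w := by rw [hv, ccwAngle_real_mul _ _ (inv_pos.2 h0), h]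
  have hvw : v = w := by
    rw [eq_mul_exp_ccwAngle hu hv1, eq_mul_exp_ccwAngle hu hw, hang]
  have hvx : x - p = (‖x - p‖ : ℂ) * w := by
    rw [← hvw, hv, ← mul_assoc, ← Complex.ofReal_mul, mul_inv_cancel₀ h0.ne', Complex.ofReal_one,
      one_mul]
  have : x = p + (‖x - p‖ : ℝ) * (p + w - p) := by rw [add_sub_cancel_left, ← hvx]; ring
  rw [this]
  exact add_mul_mem_segment (norm_nonneg _) hx1

/-- A point of the bond `[p, l]` other than `p` lies in the direction of `l` from `p`.
[cite: Harborth1974, p. 14] -/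
theorem ccwAngle_eq_of_mem_segment {p l x u : ℂ} (hx : x ∈ segment ℝ p l) (hxp : x ≠ p) :
    ccwAngle u (x - p) = ccwAngle u (l - p) := by
  obtain ⟨t, ht0, -, rfl⟩ := exists_eq_add_mul_of_mem_segment hx
  have ht : 0 < t := by
    rcases ht0.eq_or_lt with rfl | h
    · simp at hxp
    · exact h
  rw [add_sub_cancel_left, ccwAngle_real_mul _ _ ht]

/-- **An empty angular gap is an empty corner.** Let `p` be a centre of a hard configuration, `q`
a point (a neighbour of `p`, in the applications) and suppose no neighbour `k ≠ q` of `p` lies at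
counter-clockwise angle `< γ` from `q`. Then the sector of directions `(0, γ)` after `q`, out to radius `r ≤ 1/2`, does not
meet the drawing: other centres are `≥ 1` away, bonds not ending at `p` stay `> 1/2` away, and
the bonds at `p` point in directions `0` or `≥ γ`. [cite: Harborth1974, p. 14] -/
theorem disjoint_sector_drawing (hP : IsHard P) {p q : ℂ} (hp : p ∈ P)
    {γ r : ℝ} (hr : r ≤ 1 / 2) (hgap : ∀ k ∈ nbrs P p, k ≠ q → γ ≤ ccwAngle (q - p) (k - p)) :
    Disjoint (sector p (q - p) 0 γ r) (drawing P) := by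
  rw [Set.disjoint_left]
  rintro x ⟨h0, hxr, ha, hb⟩ hx
  have hxp : x ≠ p := fun h => by rw [h, sub_self, norm_zero] at h0; exact lt_irrefl _ h0
  rcases mem_drawing_iff.1 hx with hxP | ⟨d, hd, hxd⟩
  · -- another centre: too far
    have := hP p hp x hxP hxp.symm
    linarith
  · obtain ⟨⟨hd1, hd2⟩, hd12⟩ := mem_darts.1 hd
    by_cases h1 : d.1 = p
    · -- a bond at `p`, towards the neighbour `d.2`
      have hl : d.2 ∈ nbrs P p := mem_nbrs.2 ⟨hd2, by rw [← h1]; exact hd12⟩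
      rw [h1] at hxd
      have hang := ccwAngle_eq_of_mem_segment (u := q - p) hxd hxp
      by_cases hlq : d.2 = q
      · rw [hlq, ccwAngle_self] at hang; rw [hang] at ha; exact lt_irrefl _ ha
      · have := hgap d.2 hl hlq; rw [← hang] at this; linarith
    by_cases h2 : d.2 = p
    · have hl : d.1 ∈ nbrs P p := mem_nbrs.2 ⟨hd1, by rw [← h2, norm_sub_rev]; exact hd12⟩
      rw [h2, segment_symm] at hxd
      have hang := ccwAngle_eq_of_mem_segment (u := q - p) hxd hxp
      by_cases hlq : d.1 = q
      · rw [hlq, ccwAngle_self] at hang; rw [hang] at ha; exact lt_irrefl _ ha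
      · have := hgap d.1 hl hlq; rw [← hang] at this; linarith
    · -- a bond away from `p`: too far
      have := half_lt_norm_sub_of_mem_segment hP hd1 hd2 hp (Ne.symm h1) (Ne.symm h2) hd12 hxd
      linarith

end Harborth

end Literature.Geometry.DiscreteGeometry

end
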